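import Literature.NumberTheory.Automorphic.FiniteAdeleWeilAssembly
import Literature.NumberTheory.Automorphic.GlobalAdditiveCharacter
import Literature.RepresentationTheory.HeisenbergGroup.RankOneCongruence
import Literature.NumberTheory.Weil1964.AdelicThetaTensorRep
import HarnessLib

/-!
# The finite-adelic Weil representation `⊗'_v ω_{ψ_v}` in rank one and the adelic `ω_∞ ⊗ (⊗'_v ω_{ψ_v})` with its theta kernel (Weil 1964 n° 37–41; MVW Chap. 2 II.8, II.10)

For a number field `K` and a family `ψ = (ψ_v)_v` of non-trivial continuous additive characters of the
completions `K_v` (`v` finite), the local theory of `Literature/RepresentationTheory/HeisenbergGroup/`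
(rank one: the group `S̃p_{ψ_v} = MpPsi ρ_{ψ_v} ⊆ SL₂(K_v) × GL(𝒮(K_v))` of MVW II.1 with its smooth-vector
topology, the smooth Weil representation `MpPsi.toRep` on `𝒮(K_v)`, and the open subgroup
`U_v = U_{0,{1_{𝒪_v}}}` of pairs over `SL₂(𝒪_v)` fixing `1_{𝒪_v}` — `RankOneCongruence`) is fed into the
finite-adelic assembly `FiniteAdeleWeilAssembly.finiteAdeleRep` (`⊗'_v r_v` on
`𝒮(𝔸_{K,f}) = ⊗'_v 𝒮(K_v)` w.r.t. the unit vectors `1_{𝒪_v}`):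

* §1 generic transport: `compHomeomorphSB e : 𝒮(Y) ≃ₗ 𝒮(X)` along a homeomorphism `e : X ≃ₜ Y`, and the
  conjugate `repCongr ρ e` of a representation along a linear equivalence (stabilisers, fixed vectors and
  smoothness are transported);
* §2 the carrier bridge `𝒮(K_v) ≃ₗ 𝒮(K_v^ι)` for `ι` a singleton (`Homeomorph.funUnique`), sending
  `1_{𝒪_v} = unramifiedVector` to the assembly's `unitVec K ι v = 1_{𝒪_v^ι}`;
* §3 **the finite-adelic metaplectic Weil representation** `finiteAdeleWeilRep K ψ hψ ι` of the restricted
  product `Πʳ_v [S̃p_{ψ_v}, U_v]` on `𝒮((𝔸_{K,f})^ι)` (`ι` a singleton), with `1_{𝒪_v^ι}` fixed by `U_v` at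
  EVERY `v` (`unitVec_mem_fixedPoints_localWeilRep`), and **its smoothness** (`isSmooth_finiteAdeleWeilRep`)
  from `isOpen (U_v)` + smoothness of the local Weil representations; where `ψ_v` has conductor `𝒪_v`,
  `μ_v` is self-dual and `v ∤ 2`, `U_v` is the lift of `SL₂(𝒪_v)` (`unramifiedNhd_eq_unramifiedStabilizer`,
  MVW II.10), so the restricted product is the usual one at almost all places of any global `ψ`.

* §4 junction with `Weil1964/AdelicThetaTensorRep` at `ι = Fin 1`: the `Fact` that every `U_v` is open (so that
  Mathlib makes `Πʳ_v [S̃p_{ψ_v}, U_v]` a topological group), **the rank-one adelic Weil representation**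
  `rankOneAdelicWeilRep K ψ hψ ω_∞ := adelicRep ω_∞ (finiteAdeleWeilRep K ψ hψ (Fin 1))` of `G_∞ × Πʳ_v [S̃p_{ψ_v}, U_v]`
  on `𝒮(𝔸_K) = piSchwartzBruhat K (Fin 1)` for an archimedean representation `ω_∞` of a topological monoid `G_∞`
  on `𝓢(K ⊗ ℝ)` (a PARAMETER, with its strong continuity `hinf`), and the theta majorants / **continuity of the
  theta kernel** `g ↦ Θ(ω(g)Φ)` (`hasThetaMajorants_rankOneAdelicWeilRep`, `continuous_thetaDistLM_rankOneAdelicWeilRep`)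
  = `hasThetaMajorants_adelicRep_of_isSmooth` with its finite-part hypothesis DISCHARGED by `isSmooth_finiteAdeleWeilRep`.

Everything is kernel-checked from the cited files; no records, no hypotheses beyond `hψ` (and, in §4, the archimedean parameter `ω_∞` with `hinf`). `open scoped Classical` in §4 is needed (as in `AdelicSchwartzBruhatTensor`) for Mathlib's normed-space instances on `mixedSpace K`.
-/

set_option autoImplicit false

noncomputable section

open scoped RestrictedProduct NumberField
open Filter IsDedekindDomain MeasureTheory

namespace Literature.NumberTheory.Automorphic

open Literature.RepresentationTheory.HeisenbergGroup

universe uX uY uι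

/-! ## §1 Transport of Schwartz–Bruhat spaces and representations -/

section Transport

variable {X : Type uX} {Y : Type uY} [TopologicalSpace X] [TopologicalSpace Y]

/-- **composition with a homeomorphism** `e : X ≃ₜ Y`: `𝒮(Y) ≃ₗ 𝒮(X)`, `f ↦ f ∘ e`. [folklore] -/
def compHomeomorphSB (e : X ≃ₜ Y) : SchwartzBruhat Y ≃ₗ[ℂ] SchwartzBruhat X where
  toFun f := ⟨(f : Y → ℂ) ∘ e, (mem_schwartzBruhat_iff.1 f.2).1.comp_continuous e.continuous,
    (mem_schwartzBruhat_iff.1 f.2).2.comp_homeomorph e⟩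
  invFun f := ⟨(f : X → ℂ) ∘ e.symm, (mem_schwartzBruhat_iff.1 f.2).1.comp_continuous e.symm.continuous,
    (mem_schwartzBruhat_iff.1 f.2).2.comp_homeomorph e.symm⟩
  map_add' _ _ := rfl
  map_smul' _ _ := rfl
  left_inv f := Subtype.ext (funext fun y => by simp)
  right_inv f := Subtype.ext (funext fun x => by simp)

/-- formula. [folklore] -/
@[simp] theorem coe_compHomeomorphSB (e : X ≃ₜ Y) (f : SchwartzBruhat Y) :
    ((compHomeomorphSB e f : SchwartzBruhat X) : X → ℂ) = (f : Y → ℂ) ∘ e := rfl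

/-- formula for the inverse. [folklore] -/
@[simp] theorem coe_compHomeomorphSB_symm (e : X ≃ₜ Y) (f : SchwartzBruhat X) :
    (((compHomeomorphSB e).symm f : SchwartzBruhat Y) : Y → ℂ) = (f : X → ℂ) ∘ e.symm := rfl

variable {k : Type*} [CommRing k] {G : Type*} [Group G] {V : Type*} [AddCommGroup V] [Module k V]
  {W : Type*} [AddCommGroup W] [Module k W]

/-- **transport of a representation** along `e : V ≃ₗ W`: `g ↦ e ∘ ρ(g) ∘ e⁻¹`. [folklore] -/
def repCongr (ρ : Representation k G V) (e : V ≃ₗ[k] W) : Representation k G W where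
  toFun g := e.conj (ρ g)
  map_one' := by rw [map_one]; exact LinearEquiv.conj_id e
  map_mul' g h := by rw [map_mul, Module.End.mul_eq_comp, LinearEquiv.conj_comp, Module.End.mul_eq_comp]

/-- formula. [folklore] -/
@[simp] theorem repCongr_apply (ρ : Representation k G V) (e : V ≃ₗ[k] W) (g : G) (w : W) :
    repCongr ρ e g w = e (ρ g (e.symm w)) := rfl

/-- stabilisers are transported. [folklore] -/
theorem stabilizerSubgroup_repCongr (ρ : Representation k G V) (e : V ≃ₗ[k] W) (w : W) :
    (repCongr ρ e).stabilizerSubgroup w = ρ.stabilizerSubgroup (e.symm w) := by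
  ext g
  rw [Representation.mem_stabilizerSubgroup, Representation.mem_stabilizerSubgroup, repCongr_apply]
  constructor
  · intro h
    have h' := congrArg e.symm h
    rwa [LinearEquiv.symm_apply_apply] at h'
  · intro h
    rw [h, LinearEquiv.apply_symm_apply]

/-- fixed vectors are transported: `e v ∈ W^H ↔ v ∈ V^H`. [folklore] -/
theorem apply_mem_fixedPoints_repCongr (ρ : Representation k G V) (e : V ≃ₗ[k] W) (H : Subgroup G) (v : V) :
    e v ∈ (repCongr ρ e).fixedPoints H ↔ v ∈ ρ.fixedPoints H := by
  rw [Representation.mem_fixedPoints_iff_le_stabilizerSubgroup, Representation.mem_fixedPoints_iff_le_stabilizerSubgroup,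
    stabilizerSubgroup_repCongr, LinearEquiv.symm_apply_apply]

/-- smoothness is transported. [folklore] -/
theorem isSmooth_repCongr [TopologicalSpace G] {ρ : Representation k G V} (hρ : ρ.IsSmooth) (e : V ≃ₗ[k] W) :
    (repCongr ρ e).IsSmooth := fun w => by
  rw [Representation.IsSmoothVector, stabilizerSubgroup_repCongr]
  exact hρ (e.symm w)

end Transport

/-! ## §2 The carrier bridge `𝒮(F) ≃ 𝒮(F^ι)`, `ι` a singleton -/

section Bridge

variable (F : Type*) [TopologicalSpace F] (ι : Type uι) [Unique ι]

/-- `𝒮(F) ≃ₗ 𝒮(ι → F)` for a singleton `ι`: `(Φ)(x) = f(x default)`. [folklore] -/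
def funUniqueSB : SchwartzBruhat F ≃ₗ[ℂ] SchwartzBruhat (ι → F) :=
  compHomeomorphSB (Homeomorph.funUnique ι F)

/-- formula. [folklore] -/
@[simp] theorem coe_funUniqueSB_apply (f : SchwartzBruhat F) (x : ι → F) :
    ((funUniqueSB F ι f : SchwartzBruhat (ι → F)) : (ι → F) → ℂ) x = (f : F → ℂ) (x default) := rfl

end Bridge

section BridgeK

variable (ι : Type) [Unique ι] (K : Type) [Field K] [NumberField K] (v : HeightOneSpectrum (𝓞 K))

/-- for a singleton `ι`, `z ∈ 𝒪_v^ι ↔ z default ∈ 𝔭_v^0`. [folklore] -/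
theorem mem_integralBox_iff_default [Finite ι] (z : ι → v.adicCompletion K) :
    z ∈ integralBox K ι v ↔ z default ∈ primePowBall (v.adicCompletion K) 0 := by
  rw [mem_integralBox_iff, mem_primePowBall_zero_iff]
  constructor
  · exact fun h => h default
  · intro h i
    rwa [Unique.eq_default i]

/-- **the bridge sends `1_{𝒪_v}` to the unit vector `1_{𝒪_v^ι}`**. [folklore] -/
theorem funUniqueSB_unramifiedVector [Finite ι] :
    funUniqueSB (v.adicCompletion K) ι (unramifiedVector (v.adicCompletion K)) = unitVec K ι v := by
  apply Subtype.ext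
  funext z
  rw [coe_funUniqueSB_apply, coe_unitVec, unramifiedVector_apply]
  by_cases hz : z ∈ integralBox K ι v
  · rw [Set.indicator_of_mem hz, if_pos ((mem_integralBox_iff_default ι K v z).1 hz)]
  · rw [Set.indicator_of_notMem hz, if_neg (mt (mem_integralBox_iff_default ι K v z).2 hz)]

end BridgeK

/-! ## §3 The finite-adelic Weil representation of `Πʳ_v [S̃p_{ψ_v}, U_v]` -/

section Global

variable (K : Type) [Field K] [NumberField K]

/-- `K_v` has characteristic zero. [folklore] -/
instance instCharZeroAdicCompletion (v : HeightOneSpectrum (𝓞 K)) : CharZero (v.adicCompletion K) :=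
  charZero_of_injective_algebraMap (algebraMap K (v.adicCompletion K)).injective

/-- `2` is invertible in `K_v`. [folklore] -/
instance instInvertibleTwoAdicCompletion (v : HeightOneSpectrum (𝓞 K)) : Invertible (2 : v.adicCompletion K) :=
  invertibleOfNonzero two_ne_zero

variable (ψ : ∀ v : HeightOneSpectrum (𝓞 K), AddChar (v.adicCompletion K) Circle)
  (hψ : ∀ v, (ψ v).IsContinuousNontrivial)

/-- the local groups `S̃p_{ψ_v} ⊆ SL₂(K_v) × GL(𝒮(K_v))` (MVW II.1), with their smooth-vector topology.
[cite: MoeglinVignerasWaldspurger1987, Chap. 2 II.1 (B)] -/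
abbrev MpLoc (v : HeightOneSpectrum (𝓞 K)) : Type := MpPsi (rhoPsi (hψ v))

/-- the open subgroups `U_v = {(g, M) | g ∈ SL₂(𝒪_v), M 1_{𝒪_v} = 1_{𝒪_v}}`. [cite: MoeglinVignerasWaldspurger1987, Chap. 2 II.10] -/
def unramifiedNhd (v : HeightOneSpectrum (𝓞 K)) : Subgroup (MpLoc K ψ hψ v) :=
  MpPsi.smoothNhd (rankOneCongruenceBasis (v.adicCompletion K)) (rhoPsi (hψ v)) 0 {unramifiedVector (v.adicCompletion K)}

/-- `U_v` is open. [cite: MoeglinVignerasWaldspurger1987, Chap. 2 II.10] -/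
theorem isOpen_unramifiedNhd (v : HeightOneSpectrum (𝓞 K)) : IsOpen (unramifiedNhd K ψ hψ v : Set (MpLoc K ψ hψ v)) :=
  isOpen_smoothNhd_rankOne (hψ v) 0 _

/-- where `(ψ_v, μ_v)` is an unramified datum (conductor `𝒪_v`, `μ_v` self-dual, `v ∤ 2`), `U_v` is the lift of
`SL₂(𝒪_v)` normalised by `1_{𝒪_v}`. [cite: MoeglinVignerasWaldspurger1987, Chap. 2 II.10] -/
theorem unramifiedNhd_eq_unramifiedStabilizer (v : HeightOneSpectrum (𝓞 K)) [MeasurableSpace (v.adicCompletion K)]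
    [BorelSpace (v.adicCompletion K)] (μ : Measure (v.adicCompletion K)) [μ.IsAddHaarMeasure]
    (hd : UnramifiedDatum (ψ v) μ) : unramifiedNhd K ψ hψ v = unramifiedStabilizer μ hd :=
  (unramifiedStabilizer_eq_smoothNhd μ hd).symm

variable (ι : Type) [Unique ι]

/-- **the local Weil representations** `ω_{ψ_v}` of `S̃p_{ψ_v}` on `𝒮(K_v^ι)` (transported from `𝒮(K_v)`).
[cite: MoeglinVignerasWaldspurger1987, Chap. 2 II.1 (A)] -/
def localWeilRep (v : HeightOneSpectrum (𝓞 K)) :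
    Representation ℂ (MpLoc K ψ hψ v) ↥(SchwartzBruhat (ι → v.adicCompletion K)) :=
  repCongr (MpPsi.toRep (rhoPsi (hψ v))) (funUniqueSB (v.adicCompletion K) ι)

/-- the local Weil representations are smooth. [cite: MoeglinVignerasWaldspurger1987, Chap. 2 II.8] -/
theorem isSmooth_localWeilRep (v : HeightOneSpectrum (𝓞 K)) : (localWeilRep K ψ hψ ι v).IsSmooth :=
  isSmooth_repCongr (isSmooth_toRep_rankOne (hψ v)) _

variable [Fintype ι]

/-- **`1_{𝒪_v^ι}` is fixed by `U_v`, at every place**. [cite: MoeglinVignerasWaldspurger1987, Chap. 2 II.10] -/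
theorem unitVec_mem_fixedPoints_localWeilRep (v : HeightOneSpectrum (𝓞 K)) :
    unitVec K ι v ∈ (localWeilRep K ψ hψ ι v).fixedPoints (unramifiedNhd K ψ hψ v) := by
  rw [← funUniqueSB_unramifiedVector, localWeilRep, apply_mem_fixedPoints_repCongr]
  exact MpPsi.mem_fixedPoints_smoothNhd _ _ _

/-- the hypothesis `hK` of the assembly holds (everywhere, a fortiori eventually). [folklore] -/
theorem eventually_unitVec_mem_fixedPoints :
    ∀ᶠ v in cofinite, unitVec K ι v ∈ (localWeilRep K ψ hψ ι v).fixedPoints (unramifiedNhd K ψ hψ v) :=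
  Eventually.of_forall (unitVec_mem_fixedPoints_localWeilRep K ψ hψ ι)

variable [DecidableEq (HeightOneSpectrum (𝓞 K))]

/-- **the finite-adelic Weil representation `⊗'_v ω_{ψ_v}`** of `Πʳ_v [S̃p_{ψ_v}, U_v]` on `𝒮((𝔸_{K,f})^ι)`.
[cite: Weil1964, n° 37–39] -/
def finiteAdeleWeilRep :
    Representation ℂ (Πʳ v, [MpLoc K ψ hψ v, unramifiedNhd K ψ hψ v]) ↥(SchwartzBruhat (ι → FiniteAdeleRing (𝓞 K) K)) :=
  finiteAdeleRep K ι (localWeilRep K ψ hψ ι) (eventually_unitVec_mem_fixedPoints K ψ hψ ι)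

/-- action on pure tensors: `(⊗' ω)(g)(⊗_v Φ_v) = ⊗_v ω_{ψ_v}(g_v) Φ_v`. [cite: Weil1964, n° 37–39] -/
theorem finiteAdeleWeilRep_apply_piProdSB (g : Πʳ v, [MpLoc K ψ hψ v, unramifiedNhd K ψ hψ v]) (Φ : LocalSBFamily K ι) :
    finiteAdeleWeilRep K ψ hψ ι g (piProdSB K ι Φ) =
      piProdSB K ι (RestrictedFamily.smul (localWeilRep K ψ hψ ι) (eventually_unitVec_mem_fixedPoints K ψ hψ ι) g Φ) :=
  finiteAdeleRep_apply_piProdSB K ι _ _ g Φ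

/-- **`⊗'_v ω_{ψ_v}` is smooth**. [cite: MoeglinVignerasWaldspurger1987, Chap. 2 II.8] -/
theorem isSmooth_finiteAdeleWeilRep : (finiteAdeleWeilRep K ψ hψ ι).IsSmooth :=
  isSmooth_finiteAdeleRep K ι _ _ (isOpen_unramifiedNhd K ψ hψ) (isSmooth_localWeilRep K ψ hψ ι)

end Global

/-! ## §4 The adelic representation `ω_∞ ⊗ (⊗'_v ω_{ψ_v})` on `𝒮(𝔸_K)` and its theta kernel -/

section Theta

open scoped _root_.SchwartzMap Classical
open Literature.NumberTheory.Weil1964 NumberField.mixedEmbedding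

variable (K : Type) [Field K] [NumberField K]
  (ψ : ∀ v : HeightOneSpectrum (𝓞 K), AddChar (v.adicCompletion K) Circle)
  (hψ : ∀ v, (ψ v).IsContinuousNontrivial)

/-- Every `U_v ≤ S̃p_{ψ_v}(K_v)` is open (as a `Fact`, for Mathlib's restricted-product instances).
[cite: MoeglinVignerasWaldspurger1987, Chap. 2 II.10] -/
instance instFactIsOpenUnramifiedNhd :
    Fact (∀ v : HeightOneSpectrum (𝓞 K), IsOpen (unramifiedNhd K ψ hψ v : Set (MpLoc K ψ hψ v))) :=
  ⟨isOpen_unramifiedNhd K ψ hψ⟩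

/-- The restricted product `Π'_v (S̃p_{ψ_v}(K_v), U_v)` is a topological group. [folklore] -/
instance instIsTopologicalGroupFiniteAdeleMp :
    IsTopologicalGroup (Πʳ v : HeightOneSpectrum (𝓞 K), [MpLoc K ψ hψ v, unramifiedNhd K ψ hψ v]) :=
  inferInstance

variable [DecidableEq (HeightOneSpectrum (𝓞 K))]
variable {Ginf : Type*} [Monoid Ginf]

/-- **The rank-one adelic Weil representation** `ω = ω_∞ ⊗ (⊗'_v ω_{ψ_v})` of
`G_∞ × Π'_v (S̃p_{ψ_v}(K_v), U_v)` on `𝒮(𝔸_K) = piSchwartzBruhat K (Fin 1)`, for an archimedean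
representation `ω_∞` of `G_∞` on `𝓢(K ⊗ ℝ)` (a parameter).
[cite: Weil1964, n° 37–39] -/
def rankOneAdelicWeilRep (ωinf : Representation ℂ Ginf 𝓢((Fin 1 → mixedSpace K), ℂ)) :
    Representation ℂ (Ginf × (Πʳ v : HeightOneSpectrum (𝓞 K), [MpLoc K ψ hψ v, unramifiedNhd K ψ hψ v]))
      ↥(piSchwartzBruhat K (Fin 1)) :=
  adelicRep ωinf (finiteAdeleWeilRep K ψ hψ (Fin 1))

/-- `ω (g_∞, g_f) = ω_∞(g_∞) ⊗ (⊗'_v ω_{ψ_v})(g_f)`. [folklore] -/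
theorem rankOneAdelicWeilRep_apply (ωinf : Representation ℂ Ginf 𝓢((Fin 1 → mixedSpace K), ℂ))
    (g : Ginf × (Πʳ v : HeightOneSpectrum (𝓞 K), [MpLoc K ψ hψ v, unramifiedNhd K ψ hψ v])) :
    rankOneAdelicWeilRep K ψ hψ ωinf g = adelicTensorEnd (ωinf g.1) (finiteAdeleWeilRep K ψ hψ (Fin 1) g.2) :=
  adelicRep_apply _ _ g

variable [TopologicalSpace Ginf]

/-- **Theta majorants** of the rank-one adelic Weil representation, for `ω_∞` strongly continuous on `𝓢`:
the finite part `⊗'_v ω_{ψ_v}` is smooth (`isSmooth_finiteAdeleWeilRep`). [cite: Weil1964, n° 41] -/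
theorem hasThetaMajorants_rankOneAdelicWeilRep (ωinf : Representation ℂ Ginf 𝓢((Fin 1 → mixedSpace K), ℂ))
    (hinf : ∀ Φ, Continuous fun g => ωinf g Φ) :
    HasThetaMajorants (F := K) fun g Φ => rankOneAdelicWeilRep K ψ hψ ωinf g Φ :=
  hasThetaMajorants_adelicRep_of_isSmooth ωinf _ hinf (isSmooth_finiteAdeleWeilRep K ψ hψ (Fin 1))

/-- The same with `ω_∞` an `IsArchFactor`. [cite: Weil1964, n° 41] -/
theorem hasThetaMajorants_rankOneAdelicWeilRep_of_isArchFactor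
    (ωinf : Representation ℂ Ginf 𝓢((Fin 1 → mixedSpace K), ℂ)) (hA : IsArchFactor fun g Φ => ωinf g Φ) :
    HasThetaMajorants (F := K) fun g Φ => rankOneAdelicWeilRep K ψ hψ ωinf g Φ :=
  hasThetaMajorants_adelicRep_of_isArchFactor_of_isSmooth ωinf _ hA (isSmooth_finiteAdeleWeilRep K ψ hψ (Fin 1))

/-- **Continuity of the theta kernel** `g ↦ Θ(ω(g)Φ)` of the rank-one adelic Weil representation on
`G_∞ × Π'_v (S̃p_{ψ_v}(K_v), U_v)`, for `ω_∞` strongly continuous on `𝓢` (Weil 1964, n° 41, Théorème 6,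
conclusion 1, finite-adelic half in the kernel). [cite: Weil1964, n° 41] -/
theorem continuous_thetaDistLM_rankOneAdelicWeilRep
    (ωinf : Representation ℂ Ginf 𝓢((Fin 1 → mixedSpace K), ℂ)) (hinf : ∀ Φ, Continuous fun g => ωinf g Φ)
    (Φ : ↥(piSchwartzBruhat K (Fin 1))) :
    Continuous fun g => thetaDistLM K (Fin 1) (rankOneAdelicWeilRep K ψ hψ ωinf g Φ) :=
  (hasThetaMajorants_rankOneAdelicWeilRep K ψ hψ ωinf hinf).continuous_thetaDistLM Φ

/-- **Continuity of the orbit maps of the finite part**: `g_f ↦ (⊗'_v ω_{ψ_v})(g_f) Ψ` is locally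
constant on `Π'_v (S̃p_{ψ_v}, U_v)` for every `Ψ ∈ 𝒮(𝔸_{K,f})`. [cite: MoeglinVignerasWaldspurger1987, Chap. 2 II.8] -/
theorem isLocallyConstant_finiteAdeleWeilRep_apply (Ψ : FinSB K (Fin 1)) :
    IsLocallyConstant fun g : (Πʳ v : HeightOneSpectrum (𝓞 K), [MpLoc K ψ hψ v, unramifiedNhd K ψ hψ v]) =>
      finiteAdeleWeilRep K ψ hψ (Fin 1) g Ψ :=
  Representation.IsSmooth.isLocallyConstant_apply _ (isSmooth_finiteAdeleWeilRep K ψ hψ (Fin 1)) Ψ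

end Theta

end Literature.NumberTheory.Automorphic
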